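import Literature.NumberTheory.Weil1964.ThetaLift
import Literature.NumberTheory.Automorphic.WeightFormsEquivariantFamily
import Literature.NumberTheory.Automorphic.WeightFormsQuotient
import HarnessLib

/-!
# Vector-valued theta forms: the weight-`τ` form carried by a theta lift

Layer W6b-1 of the Hodge-CM model construction (tree side, kernel only): the passage from the
SCALAR theta lifts `Θ_Φ(f) ∈ C(GU ⧸ ΓU, ℂ)` of `Weil1964/ThetaLift` (one lift per Schwartz function
`Φ ∈ S(X_A)`) to the `W`-VALUED automorphic form of weight `τ` on `ΓU \ GU` of
`Automorphic/WeightForms` ("theta one-forms of `K`-type `τ`"), by Frobenius reciprocity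
(`Automorphic/WeightFormsHom.homEquiv`, `Automorphic/WeightFormsEquivariantFamily.formOfFamily`).

## The dictionary

Fix a theta-kernel datum `M` for a dual pair `(GU, G)` (tree `ThetaKernelDatum`: Weil representation
`(S, Φ) ↦ SΦ` of `Mp` on `S(X_A)`, theta distribution `Θ_Φ(S)`, splitting `s : GU × G →* Mp`), a finite
Borel measure `μ` on the compact quotient `G ⧸ Γ`, and `f ∈ C(G ⧸ Γ, ℂ)` (a character `χ′` of the compact
torus `[U(W_j)]` in [PerL §4]).  Suppose

* the Schwartz carrier `SX` is a `ℂ`-module on which `Φ ↦ Θ_Φ(S)` is linear for every `S`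
  (`WeilThetaDatum.ThetaLinear` — Weil's `Θ(S)` is a tempered DISTRIBUTION; in the concrete adelic model
  this is the tree's `thetaDistLM`, `Weil1964/AdelicThetaDistribution`);
* `j : E →ₗ[ℂ] SX` is a LINEAR FAMILY OF TEST VECTORS parametrised by a `Kc`-module `(E, σ)` which is
  THETA-EQUIVARIANT through the level-and-weight map `κ : Kc →* GU`:
  `Θ_{j(σ(k)e)}(S) = Θ_{j(e)}(S · s(κ k, 1))` for all `S` (`IsThetaEquivariant`; it holds as soon as
  `j (σ k e) = s(κ k, 1) · j(e)`, `isThetaEquivariant_of_act` — in [PerL §4]: `E ⊂ S(X_∞)` a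
  `K_∞`-stable finite-dimensional space of archimedean test vectors of `K`-type `τ^∨` tensored with a FIXED
  `K_f`-invariant finite test vector `Φ_f`, `σ = ω_∞|_{K_∞} ⊗ triv`);
* `ι : W^∨ →ₗ[ℂ] E` is a `Kc`-map from the contragredient of the weight `(W, τ)` (`W` reflexive, e.g.
  finite-dimensional).

Then `g ↦ Θ̃_{j(e)}(f)(g) := Θ_{j(e)}(f)(g⁻¹ ΓU)` (`thetaLiftFun`) is, for each `e`, a left-`ΓU`-invariant
function on `GU` with `Θ̃_{j(σ(k)e)}(f)(g) = Θ̃_{j(e)}(f)(g κ(k))` (`thetaLiftFun_mul_right`), i.e. the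
machine `e ↦ Θ̃_{j(e)}(f)` is an EQUIVARIANT FAMILY in the sense of `WeightFormsEquivariantFamily`, and

  `thetaForm M μ κ j ι f : weightForms ΓU κ τ`,  `ℓ (thetaForm … f g) = Θ̃_{j(ι ℓ)}(f)(g)`  (`apply_thetaForm`)

is THE `W`-VALUED THETA FORM OF WEIGHT `τ` attached to `(j, ι, f)`.

## Main results (all kernel, sorry-free)

* `thetaKer_add/_smul`, `thetaLift_add_left/_smul_left`, `thetaLiftFunₗ` — linearity of the kernel and of
  the lift in the Schwartz variable under `ThetaLinear`; `thetaKer_congr` — the kernel only sees `Θ`-values.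
* `thetaForm`, `apply_thetaForm`, `thetaForm_add/_smul` (linearity in `f`), `thetaFormₗ`.
* NON-VANISHING TRANSFER (the `form_of_lift` step of the existential supply, PKG `SupplyBridgeA`):
  `thetaForm_ne_zero_of_thetaLiftFun_ne_zero`, `thetaForm_ne_zero_of_thetaLift_ne_zero` — if `ι` is onto
  (e.g. `E ≅ τ^∨` irreducible) and ONE scalar lift value `Θ_{j(e)}(f)(ξ) ≠ 0`, the weight-`τ` theta form is
  `≠ 0`; and the converse characterisation `thetaForm_eq_zero_iff_of_surjective`.
* `thetaForms` — the span of the theta forms of weight `τ` over a set of test families and a set of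
  weights `f` (the automorphic side of [PerL]'s `Theta(V, c, k, Γ)` before passing to cohomology classes),
  with `thetaForm_mem_thetaForms`.
* CONTINUITY: `continuous_thetaForm`, `thetaForm_mem_contWeightForms` (finite-dimensional Hausdorff `W`) — theta
  forms lie in A1's `contWeightForms`, the domain of `toLp`/`petersson`.
* HECKE/TRANSLATE STABILITY at form level (`BallFacts.transl`, "translates of theta one-forms are theta
  one-forms"): `rightTranslate_mem_weightForms` and `rightTranslate_thetaForm` — for `h ∈ GU` centralising
  `κ(Kc)` (a finite-adelic element), `R(h) (thetaForm j f) = thetaForm j' f` for ANY linear family `j'` with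
  `Θ_{j'(e)}(S) = Θ_{j(e)}(S · s(h, 1))` (in the concrete model `j' = s(h,1) ∘ j`), `IsThetaTranslate`;
  and for a GENERAL `h` moving the level (§5b): `rightTranslateHom κ κ' η h hh hτ : weightForms ΓU κ τ →ₗ
  weightForms ΓU κ' τ'` under the pointwise compatibilities `κ'(k') h = h κ(η k')`, `τ'(k') = τ(η k')`,
  `rightTranslateHom_thetaForm`, `IsThetaTranslate.isThetaEquivariant_of_conj` (`h = 1`: restriction of level).

References: the lift and its equivariance laws are those of `Weil1964/ThetaLift` ([FleigEtAl2018, §12.3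
Definition 12.5, (12.37)–(12.38)]; Gan–Qiu–Takeda's `R(g) θ(φ) = θ(ω(g) φ)` read on the group); the
`τ`-valued packaging is Frobenius reciprocity [BorelWallach2000, VII §3; folklore].  No published
statement is asserted here: every declaration below is proved.
-/

open _root_.MeasureTheory Function Module
open Literature.MeasureTheory.Integral Literature.NumberTheory.Automorphic
open Literature.NumberTheory.Automorphic.WeightForms

namespace Literature.NumberTheory.Weil1964

universe u v

/-! ## 0. Linearity of the theta distribution in the Schwartz variable (hypothesis) -/

namespace WeilThetaDatum

variable {Mp : Type u} {SX : Type v}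

/-- **Linearity of `Φ ↦ Θ_Φ(S)`** for every `S ∈ Mp(X)_A`: the carrier `S(X_A)` is a `ℂ`-module and each
`Θ(S)` is a linear functional on it (Weil's `Θ(S)` is a tempered distribution; realised in the tree's
concrete adelic model by `thetaDistLM`).  A HYPOTHESIS on the bare datum, never asserted. [folklore] -/
def ThetaLinear [AddCommGroup SX] [Module ℂ SX] (D : WeilThetaDatum Mp SX) : Prop :=
  ∀ S : Mp, IsLinearMap ℂ fun Φ : SX => D.theta Φ S

/-- Additivity of `Θ(S)`. [folklore] -/
theorem ThetaLinear.map_add [AddCommGroup SX] [Module ℂ SX] {D : WeilThetaDatum Mp SX}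
    (h : D.ThetaLinear) (Φ Φ' : SX) (S : Mp) : D.theta (Φ + Φ') S = D.theta Φ S + D.theta Φ' S :=
  (h S).map_add Φ Φ'

/-- Homogeneity of `Θ(S)`. [folklore] -/
theorem ThetaLinear.map_smul [AddCommGroup SX] [Module ℂ SX] {D : WeilThetaDatum Mp SX}
    (h : D.ThetaLinear) (c : ℂ) (Φ : SX) (S : Mp) : D.theta (c • Φ) S = c * D.theta Φ S :=
  (h S).map_smul c Φ

end WeilThetaDatum

namespace ThetaKernelDatum

variable {Mp : Type u} {SX : Type v} [TopologicalSpace Mp] [Group Mp] [TopologicalSpace SX]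
variable {GU : Type*} [Group GU] [TopologicalSpace GU] [IsTopologicalGroup GU] {ΓU : Subgroup GU}
variable {G : Type*} [Group G] [TopologicalSpace G] [IsTopologicalGroup G] {Γ : Subgroup G}
variable (M : ThetaKernelDatum Mp SX GU ΓU G Γ)

/-! ## 1. The kernel only sees theta values; linearity of kernel and lift in `Φ` -/

/-- Two Schwartz functions with the same theta function have the same kernel. [folklore] -/
theorem thetaKer_congr {Φ Φ' : SX} (h : ∀ S : Mp, M.W.theta Φ' S = M.W.theta Φ S) :
    M.thetaKer Φ' = M.thetaKer Φ := by
  ext ⟨ξ, q⟩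
  induction ξ using QuotientGroup.induction_on with | H x => ?_
  induction q using QuotientGroup.induction_on with | H y => ?_
  rw [thetaKer_mk, thetaKer_mk, h]

/-- The lifts with the same weight `f` of two `Φ`'s with equal theta functions agree. [folklore] -/
theorem thetaLift_congr [CompactSpace (GU ⧸ ΓU)] [MeasurableSpace (G ⧸ Γ)] (μ : Measure (G ⧸ Γ)) {Φ Φ' : SX}
    (h : ∀ S : Mp, M.W.theta Φ' S = M.W.theta Φ S) (f : C(G ⧸ Γ, ℂ)) :
    M.thetaLift μ Φ' f = M.thetaLift μ Φ f := by
  rw [thetaLift_def, thetaLift_def, M.thetaKer_congr h]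

section Linear

variable [AddCommGroup SX] [Module ℂ SX]

/-- Additivity of `Φ ↦ θ_Φ`. [folklore] -/
theorem thetaKer_add (hlin : M.W.ThetaLinear) (Φ Φ' : SX) :
    M.thetaKer (Φ + Φ') = M.thetaKer Φ + M.thetaKer Φ' := by
  ext ⟨ξ, q⟩
  induction ξ using QuotientGroup.induction_on with | H x => ?_
  induction q using QuotientGroup.induction_on with | H y => ?_
  rw [ContinuousMap.add_apply, thetaKer_mk, thetaKer_mk, thetaKer_mk, hlin.map_add]

/-- Homogeneity of `Φ ↦ θ_Φ`. [folklore] -/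
theorem thetaKer_smul (hlin : M.W.ThetaLinear) (c : ℂ) (Φ : SX) :
    M.thetaKer (c • Φ) = c • M.thetaKer Φ := by
  ext ⟨ξ, q⟩
  induction ξ using QuotientGroup.induction_on with | H x => ?_
  induction q using QuotientGroup.induction_on with | H y => ?_
  rw [ContinuousMap.smul_apply, thetaKer_mk, thetaKer_mk, hlin.map_smul, smul_eq_mul]

variable [CompactSpace (GU ⧸ ΓU)] [MeasurableSpace (G ⧸ Γ)] (μ : Measure (G ⧸ Γ))

/-- **Homogeneity of the lift in `Φ`**: `Θ_{cΦ}(f) = c Θ_Φ(f)`. [folklore] -/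
theorem thetaLift_smul_left (hlin : M.W.ThetaLinear) (c : ℂ) (Φ : SX) (f : C(G ⧸ Γ, ℂ)) :
    M.thetaLift μ (c • Φ) f = c • M.thetaLift μ Φ f := by
  rw [thetaLift_def, thetaLift_def, M.thetaKer_smul hlin, KernelOp.lift_smul_left]

variable [CompactSpace (G ⧸ Γ)] [BorelSpace (G ⧸ Γ)] [IsFiniteMeasure μ]

/-- **Additivity of the lift in `Φ`**: `Θ_{Φ+Φ'}(f) = Θ_Φ(f) + Θ_{Φ'}(f)`. [folklore] -/
theorem thetaLift_add_left (hlin : M.W.ThetaLinear) (Φ Φ' : SX) (f : C(G ⧸ Γ, ℂ)) :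
    M.thetaLift μ (Φ + Φ') f = M.thetaLift μ Φ f + M.thetaLift μ Φ' f := by
  rw [thetaLift_def, thetaLift_def, thetaLift_def, M.thetaKer_add hlin, KernelOp.lift_add_left]

/-- **The lift read on the group, as a LINEAR MAP in the Schwartz variable**:
`Φ ↦ (g ↦ Θ_Φ(f)(g⁻¹ ΓU))`. [folklore] -/
noncomputable def thetaLiftFunₗ (hlin : M.W.ThetaLinear) (f : C(G ⧸ Γ, ℂ)) : SX →ₗ[ℂ] (GU → ℂ) where
  toFun Φ := M.thetaLiftFun μ Φ f
  map_add' Φ Φ' := funext fun g => by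
    rw [Pi.add_apply, thetaLiftFun_apply, thetaLiftFun_apply, thetaLiftFun_apply,
      M.thetaLift_add_left μ hlin, ContinuousMap.add_apply]
  map_smul' c Φ := funext fun g => by
    rw [RingHom.id_apply, Pi.smul_apply, thetaLiftFun_apply, thetaLiftFun_apply,
      M.thetaLift_smul_left μ hlin, ContinuousMap.smul_apply]

/-- `thetaLiftFunₗ` on points. [folklore] -/
@[simp] theorem thetaLiftFunₗ_apply (hlin : M.W.ThetaLinear) (f : C(G ⧸ Γ, ℂ)) (Φ : SX) :
    M.thetaLiftFunₗ μ hlin f Φ = M.thetaLiftFun μ Φ f := rfl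

end Linear

/-! ## 2. Theta-equivariant linear families of test vectors -/

section Family

variable {Kc : Type*} [Group Kc] (κ : Kc →* GU)
variable {E : Type*} [AddCommGroup E] [Module ℂ E] (σ : Representation ℂ Kc E)
variable [AddCommGroup SX] [Module ℂ SX]

/-- **Theta-equivariance of a linear family of test vectors `j : E → S(X_A)`** through the
level-and-weight map `κ : Kc →* GU`: `Θ_{j(σ(k) e)}(S) = Θ_{j(e)}(S · s(κ k, 1))` for all `S` — the family
intertwines `σ` with the Weil action of `κ(Kc) × 1` AS SEEN BY THE THETA DISTRIBUTION (which is all the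
lift uses). [folklore] -/
def IsThetaEquivariant (j : E →ₗ[ℂ] SX) : Prop :=
  ∀ (k : Kc) (e : E) (S : Mp), M.W.theta (j (σ k e)) S = M.W.theta (j e) (S * M.s (κ k, 1))

variable {κ σ}

omit [IsTopologicalGroup GU] [IsTopologicalGroup G] in
/-- A family which intertwines `σ` with the Weil ACTION `s(κ k, 1)` on the nose is theta-equivariant
(by the datum's law `Θ_{S'Φ}(S) = Θ_Φ(S S')`). [folklore] -/
theorem isThetaEquivariant_of_act {j : E →ₗ[ℂ] SX}
    (hj : ∀ (k : Kc) (e : E), j (σ k e) = M.W.act (M.s (κ k, 1)) (j e)) :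
    M.IsThetaEquivariant κ σ j :=
  fun k e S => by rw [hj, M.theta_act]

omit [IsTopologicalGroup GU] [IsTopologicalGroup G] in
/-- Shrinking the parameter space along a `Kc`-map preserves theta-equivariance. [folklore] -/
theorem IsThetaEquivariant.comp {j : E →ₗ[ℂ] SX} (hj : M.IsThetaEquivariant κ σ j)
    {E' : Type*} [AddCommGroup E'] [Module ℂ E'] {σ' : Representation ℂ Kc E'} (i : E' →ₗ[ℂ] E)
    (hi : ∀ (k : Kc) (e' : E'), i (σ' k e') = σ k (i e')) : M.IsThetaEquivariant κ σ' (j ∘ₗ i) :=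
  fun k e' S => by rw [LinearMap.comp_apply, LinearMap.comp_apply, hi, hj]

/-- **A theta-translate of a family**: `j'` is an `h`-translate of `j` (`h ∈ GU`) when
`Θ_{j'(e)}(S) = Θ_{j(e)}(S · s(h, 1))` — in a model where the Weil action is by linear operators,
`j' = s(h, 1) ∘ j`. [folklore] -/
def IsThetaTranslate (h : GU) (j j' : E →ₗ[ℂ] SX) : Prop :=
  ∀ (e : E) (S : Mp), M.W.theta (j' e) S = M.W.theta (j e) (S * M.s (h, 1))

omit [IsTopologicalGroup GU] [IsTopologicalGroup G] in
/-- `s(h,1) ∘ j` is an `h`-translate of `j` whenever it is available as a linear map `j'`. [folklore] -/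
theorem isThetaTranslate_of_act {h : GU} {j j' : E →ₗ[ℂ] SX}
    (hj' : ∀ e, j' e = M.W.act (M.s (h, 1)) (j e)) : M.IsThetaTranslate h j j' :=
  fun e S => by rw [hj', M.theta_act]

omit [IsTopologicalGroup GU] [IsTopologicalGroup G] in
/-- A translate by an element CENTRALISING `κ(Kc)` of a theta-equivariant family is theta-equivariant
(finite-adelic Hecke translates do not disturb the archimedean `K`-type nor the level). [folklore] -/
theorem IsThetaTranslate.isThetaEquivariant {h : GU} {j j' : E →ₗ[ℂ] SX} (ht : M.IsThetaTranslate h j j')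
    (hj : M.IsThetaEquivariant κ σ j) (hh : ∀ k : Kc, Commute h (κ k)) :
    M.IsThetaEquivariant κ σ j' := fun k e S => by
  rw [ht, ht, hj, mul_assoc, mul_assoc, ← map_mul, ← map_mul, Prod.mk_mul_mk, Prod.mk_mul_mk, mul_one,
    (hh k).eq]

omit [IsTopologicalGroup GU] [IsTopologicalGroup G] in
/-- A translate by a GENERAL `h ∈ GU` of a theta-equivariant family is theta-equivariant for the conjugated
weight group: if `κ' : Kc' →* GU`, `η : Kc' →* Kc` satisfy `κ'(k') h = h κ(η k')` (e.g. `Kc' = K_∞ × (K_f ∩ h K_f h⁻¹)`,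
`κ' =` inclusion, `η =` conjugation by `h⁻¹` on the finite part — a Hecke translate moving the level) and
`σ'(k') = σ(η k')` pointwise, then an `h`-translate `j'` of `j` is `(κ', σ')`-equivariant. [folklore] -/
theorem IsThetaTranslate.isThetaEquivariant_of_conj {Kc' : Type*} [Group Kc'] {κ' : Kc' →* GU} {η : Kc' →* Kc}
    {σ' : Representation ℂ Kc' E} {h : GU} {j j' : E →ₗ[ℂ] SX} (ht : M.IsThetaTranslate h j j')
    (hj : M.IsThetaEquivariant κ σ j) (hh : ∀ k' : Kc', κ' k' * h = h * κ (η k'))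
    (hσ : ∀ k' : Kc', σ' k' = σ (η k')) :
    M.IsThetaEquivariant κ' σ' j' := fun k' e S => by
  rw [hσ, ht, ht, hj, mul_assoc, mul_assoc, ← map_mul, ← map_mul, Prod.mk_mul_mk, Prod.mk_mul_mk, mul_one,
    hh k']

end Family

/-! ## 3. The weight-`τ` theta form -/

section Form

variable [AddCommGroup SX] [Module ℂ SX]
variable [CompactSpace (GU ⧸ ΓU)] [CompactSpace (G ⧸ Γ)] [MeasurableSpace (G ⧸ Γ)] [BorelSpace (G ⧸ Γ)]
  (μ : Measure (G ⧸ Γ)) [IsFiniteMeasure μ] (hlin : M.W.ThetaLinear)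
variable {Kc : Type*} [Group Kc] (κ : Kc →* GU)
variable {E : Type*} [AddCommGroup E] [Module ℂ E] {σ : Representation ℂ Kc E}
variable (j : E →ₗ[ℂ] SX)

/-- The machine `e ↦ Θ̃_{j(e)}(f)` has left-`ΓU`-invariant values. [folklore] -/
theorem thetaLiftFunₗ_comp_mem (f : C(G ⧸ Γ, ℂ)) (e : E) :
    (M.thetaLiftFunₗ μ hlin f ∘ₗ j) e ∈ leftInvariantFun ℂ ℂ ΓU :=
  fun _ hγ g => M.thetaLiftFun_mul_left μ (j e) f hγ g

variable (hj : M.IsThetaEquivariant κ σ j)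
include hj

/-- The machine `e ↦ Θ̃_{j(e)}(f)` intertwines `σ` with right translation through `κ`:
`Θ̃_{j(σ(k)e)}(f)(g) = Θ̃_{j(e)}(f)(g κ(k))`. [folklore] -/
theorem thetaLiftFunₗ_comp_equivariant (f : C(G ⧸ Γ, ℂ)) (k : Kc) (e : E) :
    (M.thetaLiftFunₗ μ hlin f ∘ₗ j) (σ k e) = rightRep ℂ κ ℂ k ((M.thetaLiftFunₗ μ hlin f ∘ₗ j) e) := by
  funext g
  rw [LinearMap.comp_apply, LinearMap.comp_apply, rightRep_apply, thetaLiftFunₗ_apply, thetaLiftFunₗ_apply,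
    M.thetaLiftFun_mul_right μ (j e) f g (κ k), thetaLiftFun_apply, thetaLiftFun_apply]
  exact congrFun (congrArg DFunLike.coe (M.thetaLift_congr μ (fun S => (hj k e S).trans
    (M.theta_act (j e) S (M.s (κ k, 1))).symm) f)) _

variable {W : Type*} [AddCommGroup W] [Module ℂ W] {τ : Representation ℂ Kc W} [IsReflexive ℂ W]
variable (ι : Dual ℂ W →ₗ[ℂ] E) (hι : ∀ (k : Kc) (ℓ : Dual ℂ W), ι (τ.dual k ℓ) = σ k (ι ℓ))

/-- **The `W`-valued theta form of weight `τ`** attached to the test family `j`, the `Kc`-map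
`ι : W^∨ → E` and the weight function `f ∈ C(G ⧸ Γ, ℂ)`: the unique `F : GU → W` with
`ℓ (F g) = Θ_{j(ι ℓ)}(f)(g⁻¹ ΓU)` for all `ℓ ∈ W^∨`; it is left `ΓU`-invariant with
`F (g κ(k)) = τ(k)⁻¹ F(g)`. [folklore] -/
noncomputable def thetaForm (f : C(G ⧸ Γ, ℂ)) : weightForms ΓU κ τ :=
  WeightForms.formOfFamily (M.thetaLiftFunₗ μ hlin f ∘ₗ j) (M.thetaLiftFunₗ_comp_mem μ hlin j f)
    (M.thetaLiftFunₗ_comp_equivariant μ hlin κ j hj f) ι hι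

/-- **Defining property**: `ℓ (thetaForm … f g) = Θ̃_{j(ι ℓ)}(f)(g) = Θ_{j(ι ℓ)}(f)(g⁻¹ ΓU)`. [folklore] -/
@[simp] theorem apply_thetaForm (f : C(G ⧸ Γ, ℂ)) (g : GU) (ℓ : Dual ℂ W) :
    ℓ ((M.thetaForm μ hlin κ j hj ι hι f : GU → W) g) = M.thetaLiftFun μ (j (ι ℓ)) f g := by
  rw [thetaForm, WeightForms.apply_formOfFamily, LinearMap.comp_apply, thetaLiftFunₗ_apply]

/-- The same, with the lift on the quotient. [folklore] -/
theorem apply_thetaForm' (f : C(G ⧸ Γ, ℂ)) (g : GU) (ℓ : Dual ℂ W) :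
    ℓ ((M.thetaForm μ hlin κ j hj ι hι f : GU → W) g) = M.thetaLift μ (j (ι ℓ)) f (QuotientGroup.mk g⁻¹) :=
  M.apply_thetaForm μ hlin κ j hj ι hι f g ℓ

/-- The theta form is a weight-`τ` form (membership restated). [folklore] -/
theorem thetaForm_mem (f : C(G ⧸ Γ, ℂ)) :
    ((M.thetaForm μ hlin κ j hj ι hι f : weightForms ΓU κ τ) : GU → W) ∈ weightForms ΓU κ τ :=
  (M.thetaForm μ hlin κ j hj ι hι f).2

/-- **Vanishing criterion**: the theta form is `0` iff every scalar lift `Θ̃_{j(ι ℓ)}(f)` vanishes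
identically. [folklore] -/
theorem thetaForm_eq_zero_iff (f : C(G ⧸ Γ, ℂ)) :
    M.thetaForm μ hlin κ j hj ι hι f = 0 ↔ ∀ (ℓ : Dual ℂ W) (g : GU), M.thetaLiftFun μ (j (ι ℓ)) f g = 0 := by
  rw [thetaForm, WeightForms.formOfFamily_eq_zero_iff]
  rfl

/-- **Pointwise non-vanishing**: a nonzero scalar lift value `Θ̃_{j(ι ℓ)}(f)(g) ≠ 0` makes the VALUE
of the theta form at `g` nonzero (what is needed when only one double coset `G(F) g G_∞ K_f` is visible
classically, i.e. after restriction to the archimedean group through `g`). [folklore] -/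
theorem thetaForm_apply_ne_zero (f : C(G ⧸ Γ, ℂ)) {ℓ : Dual ℂ W} {g : GU}
    (h : M.thetaLiftFun μ (j (ι ℓ)) f g ≠ 0) : (M.thetaForm μ hlin κ j hj ι hι f : GU → W) g ≠ 0 :=
  fun h0 => h (by rw [← M.apply_thetaForm μ hlin κ j hj ι hι f g ℓ, h0, map_zero])

/-- One nonzero scalar lift value along `ι` makes the theta form nonzero. [folklore] -/
theorem thetaForm_ne_zero_of_apply_ne_zero (f : C(G ⧸ Γ, ℂ)) {ℓ : Dual ℂ W} {g : GU}
    (h : M.thetaLiftFun μ (j (ι ℓ)) f g ≠ 0) : M.thetaForm μ hlin κ j hj ι hι f ≠ 0 :=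
  fun h0 => h ((M.thetaForm_eq_zero_iff μ hlin κ j hj ι hι f).1 h0 ℓ g)

/-- **Vanishing criterion, `ι` onto** (e.g. `E ≅ τ^∨`): the theta form is `0` iff `Θ̃_{j(e)}(f) ≡ 0` for
EVERY test vector `e ∈ E`. [folklore] -/
theorem thetaForm_eq_zero_iff_of_surjective (hsurj : Surjective ι) (f : C(G ⧸ Γ, ℂ)) :
    M.thetaForm μ hlin κ j hj ι hι f = 0 ↔ ∀ (e : E) (g : GU), M.thetaLiftFun μ (j e) f g = 0 := by
  rw [thetaForm, WeightForms.formOfFamily_eq_zero_iff_of_surjective _ _ _ _ _ hsurj]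
  rfl

/-- **NON-VANISHING TRANSFER (group form)**: if `ι` is onto and a single scalar lift value
`Θ̃_{j(e)}(f)(g₀) ≠ 0`, the weight-`τ` theta form is nonzero — the `form_of_lift` step of the existential
theta supply. [folklore] -/
theorem thetaForm_ne_zero_of_thetaLiftFun_ne_zero (hsurj : Surjective ι) (f : C(G ⧸ Γ, ℂ)) {e : E}
    {g₀ : GU} (h : M.thetaLiftFun μ (j e) f g₀ ≠ 0) : M.thetaForm μ hlin κ j hj ι hι f ≠ 0 :=
  fun h0 => h ((M.thetaForm_eq_zero_iff_of_surjective μ hlin κ j hj ι hι hsurj f).1 h0 e g₀)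

/-- **NON-VANISHING TRANSFER (quotient form)**: if `ι` is onto and `Θ_{j(e)}(f)(ξ) ≠ 0` at one point
`ξ ∈ GU ⧸ ΓU`, the weight-`τ` theta form is nonzero. [folklore] -/
theorem thetaForm_ne_zero_of_thetaLift_ne_zero (hsurj : Surjective ι) (f : C(G ⧸ Γ, ℂ)) {e : E}
    {ξ : GU ⧸ ΓU} (h : M.thetaLift μ (j e) f ξ ≠ 0) : M.thetaForm μ hlin κ j hj ι hι f ≠ 0 := by
  induction ξ using QuotientGroup.induction_on with | H x => ?_
  refine M.thetaForm_ne_zero_of_thetaLiftFun_ne_zero μ hlin κ j hj ι hι hsurj f (e := e) (g₀ := x⁻¹) ?_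
  rwa [thetaLiftFun_apply, inv_inv]

/-- **Non-vanishing characterisation, `ι` onto**: the theta form is nonzero iff some scalar lift
`Θ_{j(e)}(f)` is not identically zero on `GU ⧸ ΓU`. [folklore] -/
theorem thetaForm_ne_zero_iff_of_surjective (hsurj : Surjective ι) (f : C(G ⧸ Γ, ℂ)) :
    M.thetaForm μ hlin κ j hj ι hι f ≠ 0 ↔ ∃ (e : E) (ξ : GU ⧸ ΓU), M.thetaLift μ (j e) f ξ ≠ 0 := by
  refine ⟨fun h => ?_, fun ⟨e, ξ, h⟩ => M.thetaForm_ne_zero_of_thetaLift_ne_zero μ hlin κ j hj ι hι hsurj f h⟩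
  by_contra hall
  simp only [ne_eq, not_exists, not_not] at hall
  exact h ((M.thetaForm_eq_zero_iff_of_surjective μ hlin κ j hj ι hι hsurj f).2
    fun e g => by rw [thetaLiftFun_apply]; exact hall e _)

/-- **Additivity in the weight function**: `thetaForm (f + f') = thetaForm f + thetaForm f'`. [folklore] -/
theorem thetaForm_add (f f' : C(G ⧸ Γ, ℂ)) :
    M.thetaForm μ hlin κ j hj ι hι (f + f') =
      M.thetaForm μ hlin κ j hj ι hι f + M.thetaForm μ hlin κ j hj ι hι f' := by
  apply (homEquiv ΓU κ τ).injective
  rw [map_add, thetaForm, thetaForm, thetaForm, WeightForms.homEquiv_formOfFamily,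
    WeightForms.homEquiv_formOfFamily, WeightForms.homEquiv_formOfFamily]
  apply Subtype.ext
  ext ℓ g
  simp only [WeightForms.coe_ofFamily, Submodule.coe_add, LinearMap.add_apply, LinearMap.comp_apply,
    thetaLiftFunₗ_apply, Pi.add_apply, thetaLiftFun_apply, M.thetaLift_add μ, ContinuousMap.add_apply]

/-- **Homogeneity in the weight function**: `thetaForm (c • f) = c • thetaForm f`. [folklore] -/
theorem thetaForm_smul (c : ℂ) (f : C(G ⧸ Γ, ℂ)) :
    M.thetaForm μ hlin κ j hj ι hι (c • f) = c • M.thetaForm μ hlin κ j hj ι hι f := by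
  apply (homEquiv ΓU κ τ).injective
  rw [map_smul, thetaForm, thetaForm, WeightForms.homEquiv_formOfFamily, WeightForms.homEquiv_formOfFamily]
  apply Subtype.ext
  ext ℓ g
  simp only [WeightForms.coe_ofFamily, Submodule.coe_smul, LinearMap.smul_apply, LinearMap.comp_apply,
    thetaLiftFunₗ_apply, Pi.smul_apply, thetaLiftFun_apply, M.thetaLift_smul μ, ContinuousMap.smul_apply]

/-- **The theta form as a linear map in the weight function** `f ↦ thetaForm … f`
(`C(G ⧸ Γ, ℂ) →ₗ weightForms ΓU κ τ`; in [PerL §4] `f` runs over characters `χ′` of `[U(W_j)]`). [folklore] -/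
noncomputable def thetaFormₗ : C(G ⧸ Γ, ℂ) →ₗ[ℂ] weightForms ΓU κ τ where
  toFun := M.thetaForm μ hlin κ j hj ι hι
  map_add' := M.thetaForm_add μ hlin κ j hj ι hι
  map_smul' c f := by rw [RingHom.id_apply]; exact M.thetaForm_smul μ hlin κ j hj ι hι c f

/-- `thetaFormₗ` on points. [folklore] -/
@[simp] theorem thetaFormₗ_apply (f : C(G ⧸ Γ, ℂ)) :
    M.thetaFormₗ μ hlin κ j hj ι hι f = M.thetaForm μ hlin κ j hj ι hι f := rfl

end Form

/-! ## 4. The space of theta forms of weight `τ` -/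

section Span

variable [AddCommGroup SX] [Module ℂ SX]
variable [CompactSpace (GU ⧸ ΓU)] [CompactSpace (G ⧸ Γ)] [MeasurableSpace (G ⧸ Γ)] [BorelSpace (G ⧸ Γ)]
  (μ : Measure (G ⧸ Γ)) [IsFiniteMeasure μ] (hlin : M.W.ThetaLinear)
variable {Kc : Type*} [Group Kc] (κ : Kc →* GU)
variable {E : Type*} [AddCommGroup E] [Module ℂ E] (σ : Representation ℂ Kc E)
variable {W : Type*} [AddCommGroup W] [Module ℂ W] [IsReflexive ℂ W] {τ : Representation ℂ Kc W}
variable (ι : Dual ℂ W →ₗ[ℂ] E) (hι : ∀ (k : Kc) (ℓ : Dual ℂ W), ι (τ.dual k ℓ) = σ k (ι ℓ))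

/-- **The space of theta forms of weight `τ`** spanned by the theta forms `thetaForm j f` with test
family `j` in a set `𝓙` of theta-equivariant linear families (e.g. `Φ_∞ ↦ Φ_∞ ⊗ Φ_f`, `Φ_f` of level `K_f`)
and weight function `f` in a set `𝓕 ⊆ C(G ⧸ Γ, ℂ)` (e.g. the characters of `[U(W_j)]` of a fixed
archimedean type) — the automorphic side of [PerL]'s `Theta(V, c, k, Γ)`. [folklore] -/
noncomputable def thetaForms (𝓙 : Set {j : E →ₗ[ℂ] SX // M.IsThetaEquivariant κ σ j})
    (𝓕 : Set C(G ⧸ Γ, ℂ)) : Submodule ℂ (weightForms ΓU κ τ) :=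
  Submodule.span ℂ {F | ∃ j ∈ 𝓙, ∃ f ∈ 𝓕, F = M.thetaForm μ hlin κ j.1 j.2 ι hι f}

/-- Each generating theta form lies in the space of theta forms. [folklore] -/
theorem thetaForm_mem_thetaForms {𝓙 : Set {j : E →ₗ[ℂ] SX // M.IsThetaEquivariant κ σ j}}
    {𝓕 : Set C(G ⧸ Γ, ℂ)} {j : {j : E →ₗ[ℂ] SX // M.IsThetaEquivariant κ σ j}} (hj : j ∈ 𝓙)
    {f : C(G ⧸ Γ, ℂ)} (hf : f ∈ 𝓕) :
    M.thetaForm μ hlin κ j.1 j.2 ι hι f ∈ M.thetaForms μ hlin κ σ ι hι 𝓙 𝓕 :=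
  Submodule.subset_span ⟨j, hj, f, hf, rfl⟩

/-- Monotonicity of the space of theta forms in the generating sets. [folklore] -/
theorem thetaForms_mono {𝓙 𝓙' : Set {j : E →ₗ[ℂ] SX // M.IsThetaEquivariant κ σ j}}
    {𝓕 𝓕' : Set C(G ⧸ Γ, ℂ)} (hJ : 𝓙 ⊆ 𝓙') (hF : 𝓕 ⊆ 𝓕') :
    M.thetaForms μ hlin κ σ ι hι 𝓙 𝓕 ≤ M.thetaForms μ hlin κ σ ι hι 𝓙' 𝓕' :=
  Submodule.span_mono fun _ ⟨j, hj, f, hf, h⟩ => ⟨j, hJ hj, f, hF hf, h⟩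

/-- **The space of theta forms is nonzero as soon as one scalar lift value is** (`ι` onto). [folklore] -/
theorem thetaForms_ne_bot_of_thetaLift_ne_zero (hsurj : Surjective ι)
    {𝓙 : Set {j : E →ₗ[ℂ] SX // M.IsThetaEquivariant κ σ j}} {𝓕 : Set C(G ⧸ Γ, ℂ)}
    {j : {j : E →ₗ[ℂ] SX // M.IsThetaEquivariant κ σ j}} (hj : j ∈ 𝓙) {f : C(G ⧸ Γ, ℂ)} (hf : f ∈ 𝓕)
    {e : E} {ξ : GU ⧸ ΓU} (h : M.thetaLift μ (j.1 e) f ξ ≠ 0) :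
    ∃ F ∈ M.thetaForms μ hlin κ σ ι hι 𝓙 𝓕, F ≠ 0 :=
  ⟨_, M.thetaForm_mem_thetaForms μ hlin κ σ ι hι hj hf,
    M.thetaForm_ne_zero_of_thetaLift_ne_zero μ hlin κ j.1 j.2 ι hι hsurj f h⟩

end Span

/-! ## 5. Translates of theta forms are theta forms -/

section Translate

variable {Kc : Type*} [Group Kc] (κ : Kc →* GU)
variable {W : Type*} [AddCommGroup W] [Module ℂ W] {τ : Representation ℂ Kc W}

omit [TopologicalSpace GU] [IsTopologicalGroup GU] in
/-- Right translation `(R(h) F)(g) = F(g h)` by an element `h` CENTRALISING `κ(Kc)` preserves the weight-`τ`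
forms on `ΓU \ GU` (finite-adelic Hecke translates). [folklore] -/
theorem rightTranslate_mem_weightForms {h : GU} (hh : ∀ k : Kc, Commute h (κ k)) {F : GU → W}
    (hF : F ∈ weightForms ΓU κ τ) : (fun g => F (g * h)) ∈ weightForms ΓU κ τ := by
  refine ⟨fun γ hγ g => ?_, fun k g => ?_⟩
  · simp only [mul_assoc, hF.1 γ hγ (g * h)]
  · simp only
    rw [mul_assoc, ← (hh k).eq, ← mul_assoc, hF.2 k (g * h)]

/-- **Right translation as a linear endomorphism of `weightForms ΓU κ τ`** for `h` centralising `κ(Kc)`.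
[folklore] -/
def rightTranslate (h : GU) (hh : ∀ k : Kc, Commute h (κ k)) : weightForms ΓU κ τ →ₗ[ℂ] weightForms ΓU κ τ where
  toFun F := ⟨fun g => (F : GU → W) (g * h), rightTranslate_mem_weightForms κ hh F.2⟩
  map_add' _ _ := Subtype.ext (funext fun _ => rfl)
  map_smul' _ _ := Subtype.ext (funext fun _ => rfl)

omit [TopologicalSpace GU] [IsTopologicalGroup GU] in
/-- `rightTranslate` on points. [folklore] -/
@[simp] theorem rightTranslate_apply (h : GU) (hh : ∀ k : Kc, Commute h (κ k)) (F : weightForms ΓU κ τ)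
    (g : GU) : (rightTranslate κ h hh F : GU → W) g = (F : GU → W) (g * h) := rfl

variable [AddCommGroup SX] [Module ℂ SX]
variable [CompactSpace (GU ⧸ ΓU)] [CompactSpace (G ⧸ Γ)] [MeasurableSpace (G ⧸ Γ)] [BorelSpace (G ⧸ Γ)]
  (μ : Measure (G ⧸ Γ)) [IsFiniteMeasure μ] (hlin : M.W.ThetaLinear)
variable {E : Type*} [AddCommGroup E] [Module ℂ E] {σ : Representation ℂ Kc E}
variable [IsReflexive ℂ W]
variable (ι : Dual ℂ W →ₗ[ℂ] E) (hι : ∀ (k : Kc) (ℓ : Dual ℂ W), ι (τ.dual k ℓ) = σ k (ι ℓ))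

/-- **Translates of theta forms are theta forms** (`BallFacts.transl` at form level): for `h ∈ GU`
centralising `κ(Kc)` and `j'` an `h`-translate of the theta-equivariant family `j`
(`Θ_{j'(e)}(S) = Θ_{j(e)}(S · s(h,1))`, e.g. `j' = s(h,1) ∘ j`),
`R(h) (thetaForm j f) = thetaForm j' f`. [folklore] -/
theorem rightTranslate_thetaForm {h : GU} (hh : ∀ k : Kc, Commute h (κ k)) {j j' : E →ₗ[ℂ] SX}
    (hj : M.IsThetaEquivariant κ σ j) (ht : M.IsThetaTranslate h j j') (f : C(G ⧸ Γ, ℂ)) :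
    rightTranslate κ h hh (M.thetaForm μ hlin κ j hj ι hι f) =
      M.thetaForm μ hlin κ j' (ht.isThetaEquivariant M hj hh) ι hι f := by
  apply Subtype.ext
  funext g
  rw [rightTranslate_apply]
  refine WeightForms.eq_of_forall_dual_eq (R := ℂ) fun ℓ => ?_
  rw [apply_thetaForm, apply_thetaForm, M.thetaLiftFun_mul_right μ, thetaLiftFun_apply, thetaLiftFun_apply,
    M.thetaLift_congr μ (Φ := j' (ι ℓ)) (Φ' := M.W.act (M.s (h, 1)) (j (ι ℓ)))
      (fun S => by rw [M.theta_act, ht])]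

end Translate

/-! ### 5b. Translates moving the level (general `h`, conjugated weight group) -/

section TranslateLevel

variable {Kc : Type*} [Group Kc] (κ : Kc →* GU)
variable {Kc' : Type*} [Group Kc'] (κ' : Kc' →* GU) (η : Kc' →* Kc)
variable {W : Type*} [AddCommGroup W] [Module ℂ W] {τ : Representation ℂ Kc W} {τ' : Representation ℂ Kc' W}

omit [TopologicalSpace GU] [IsTopologicalGroup GU] in
/-- Right translation by a GENERAL `h ∈ GU` maps weight-`(κ, τ)` forms to weight-`(κ', τ')` forms whenever
`κ'(k') h = h κ(η k')` and `τ'(k') = τ(η k')` for all `k'` (Hecke translates by `h ∈ G(𝔸_f)`: the level moves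
to `K_f ∩ h K_f h⁻¹`, the archimedean `K`-type is unchanged; the compatibilities are stated POINTWISE so that a
consumer's own `κ_{Γ'}`, `τ_{Γ'}` need not be syntactically `κ ∘ η`, `τ ∘ η`). [folklore] -/
theorem rightTranslate_mem_weightForms_of_conj {h : GU} (hh : ∀ k' : Kc', κ' k' * h = h * κ (η k'))
    (hτ : ∀ k' : Kc', τ' k' = τ (η k')) {F : GU → W} (hF : F ∈ weightForms ΓU κ τ) :
    (fun g => F (g * h)) ∈ weightForms ΓU κ' τ' := by
  refine ⟨fun γ hγ g => ?_, fun k' g => ?_⟩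
  · simp only [mul_assoc, hF.1 γ hγ (g * h)]
  · show F (g * κ' k' * h) = τ' k'⁻¹ (F (g * h))
    rw [hτ, map_inv, mul_assoc, hh k', ← mul_assoc, hF.2 (η k') (g * h)]

/-- **Right translation by a general `h` as a linear map `weightForms ΓU κ τ → weightForms ΓU κ' τ'`**
(conjugated weight group `κ'(k') h = h κ(η k')`, restricted type `τ'(k') = τ(η k')`). [folklore] -/
def rightTranslateHom (h : GU) (hh : ∀ k' : Kc', κ' k' * h = h * κ (η k')) (hτ : ∀ k' : Kc', τ' k' = τ (η k')) :
    weightForms ΓU κ τ →ₗ[ℂ] weightForms ΓU κ' τ' where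
  toFun F := ⟨fun g => (F : GU → W) (g * h), rightTranslate_mem_weightForms_of_conj κ κ' η hh hτ F.2⟩
  map_add' _ _ := Subtype.ext (funext fun _ => rfl)
  map_smul' _ _ := Subtype.ext (funext fun _ => rfl)

omit [TopologicalSpace GU] [IsTopologicalGroup GU] in
/-- `rightTranslateHom` on points. [folklore] -/
@[simp] theorem rightTranslateHom_apply (h : GU) (hh : ∀ k' : Kc', κ' k' * h = h * κ (η k'))
    (hτ : ∀ k' : Kc', τ' k' = τ (η k')) (F : weightForms ΓU κ τ) (g : GU) :
    (rightTranslateHom κ κ' η h hh hτ F : GU → W) g = (F : GU → W) (g * h) := rfl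

omit [TopologicalSpace GU] [IsTopologicalGroup GU] [Group GU] in
/-- The dual of a restricted representation is the restricted dual: `τ'(k') = τ(η k')` for all `k'` gives
`τ'^∨(k') = τ^∨(η k')`. [folklore] -/
theorem dual_apply_of_restrict (hτ : ∀ k' : Kc', τ' k' = τ (η k')) (k' : Kc') : τ'.dual k' = τ.dual (η k') := by
  rw [Representation.dual_apply, Representation.dual_apply, hτ, map_inv]

variable {E : Type*} [AddCommGroup E] [Module ℂ E] {σ : Representation ℂ Kc E} {σ' : Representation ℂ Kc' E}
variable [IsReflexive ℂ W]
variable (ι : Dual ℂ W →ₗ[ℂ] E) (hι : ∀ (k : Kc) (ℓ : Dual ℂ W), ι (τ.dual k ℓ) = σ k (ι ℓ))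

omit [TopologicalSpace GU] [IsTopologicalGroup GU] [Group GU] [IsReflexive ℂ W] in
include hι in
/-- An intertwiner `ι : τ^∨ → σ` is an intertwiner `τ'^∨ → σ'` for the restricted `τ'(k') = τ(η k')`,
`σ'(k') = σ(η k')`. [folklore] -/
theorem intertwine_of_restrict (hτ : ∀ k' : Kc', τ' k' = τ (η k')) (hσ : ∀ k' : Kc', σ' k' = σ (η k'))
    (k' : Kc') (ℓ : Dual ℂ W) : ι (τ'.dual k' ℓ) = σ' k' (ι ℓ) := by
  rw [dual_apply_of_restrict η hτ, hι, hσ]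

variable [AddCommGroup SX] [Module ℂ SX]
variable [CompactSpace (GU ⧸ ΓU)] [CompactSpace (G ⧸ Γ)] [MeasurableSpace (G ⧸ Γ)] [BorelSpace (G ⧸ Γ)]
  (μ : Measure (G ⧸ Γ)) [IsFiniteMeasure μ] (hlin : M.W.ThetaLinear)

/-- **Hecke translates of theta forms are theta forms, with the level moved** (`BallFacts.transl` / N33b at
form level, general `h`): for `κ'(k') h = h κ(η k')`, `τ'(k') = τ(η k')`, `σ'(k') = σ(η k')` and `j'` an
`h`-translate of the theta-equivariant family `j`, `R(h) (thetaForm κ j f) = thetaForm κ' j' f` as a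
weight-`(κ', τ')` form, `j'` being `(κ', σ')`-equivariant by `IsThetaTranslate.isThetaEquivariant_of_conj`.
The case `h = 1`, `κ' = κ ∘ η` is RESTRICTION OF LEVEL (`BallFacts.saturate` at form level). [folklore] -/
theorem rightTranslateHom_thetaForm {h : GU} (hh : ∀ k' : Kc', κ' k' * h = h * κ (η k'))
    (hτ : ∀ k' : Kc', τ' k' = τ (η k')) (hσ : ∀ k' : Kc', σ' k' = σ (η k'))
    {j j' : E →ₗ[ℂ] SX} (hj : M.IsThetaEquivariant κ σ j) (ht : M.IsThetaTranslate h j j')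
    (f : C(G ⧸ Γ, ℂ)) :
    rightTranslateHom κ κ' η h hh hτ (M.thetaForm μ hlin κ j hj ι hι f) =
      M.thetaForm μ hlin κ' j' (ht.isThetaEquivariant_of_conj M hj hh hσ) ι
        (intertwine_of_restrict η ι hι hτ hσ) f := by
  apply Subtype.ext
  funext g
  rw [rightTranslateHom_apply]
  refine WeightForms.eq_of_forall_dual_eq (R := ℂ) fun ℓ => ?_
  rw [apply_thetaForm, apply_thetaForm, M.thetaLiftFun_mul_right μ, thetaLiftFun_apply, thetaLiftFun_apply,
    M.thetaLift_congr μ (Φ := j' (ι ℓ)) (Φ' := M.W.act (M.s (h, 1)) (j (ι ℓ)))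
      (fun S => by rw [M.theta_act, ht])]

end TranslateLevel

/-! ## 6. Continuity: theta forms are continuous weight forms -/

section Continuity

variable [AddCommGroup SX] [Module ℂ SX]
variable [CompactSpace (GU ⧸ ΓU)] [CompactSpace (G ⧸ Γ)] [MeasurableSpace (G ⧸ Γ)] [BorelSpace (G ⧸ Γ)]
  (μ : Measure (G ⧸ Γ)) [IsFiniteMeasure μ] (hlin : M.W.ThetaLinear)
variable {Kc : Type*} [Group Kc] (κ : Kc →* GU)
variable {E : Type*} [AddCommGroup E] [Module ℂ E] {σ : Representation ℂ Kc E}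
variable (j : E →ₗ[ℂ] SX) (hj : M.IsThetaEquivariant κ σ j)
variable {W : Type*} [AddCommGroup W] [Module ℂ W] {τ : Representation ℂ Kc W} [IsReflexive ℂ W]
variable (ι : Dual ℂ W →ₗ[ℂ] E) (hι : ∀ (k : Kc) (ℓ : Dual ℂ W), ι (τ.dual k ℓ) = σ k (ι ℓ))

omit [AddCommGroup SX] [Module ℂ SX] [CompactSpace (G ⧸ Γ)] [BorelSpace (G ⧸ Γ)] [IsFiniteMeasure μ] in
/-- The lift read on the group is continuous (`Θ_Φ(f)` is continuous on `GU ⧸ ΓU`). [folklore] -/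
theorem continuous_thetaLiftFun (Φ : SX) (f : C(G ⧸ Γ, ℂ)) : Continuous (M.thetaLiftFun μ Φ f) :=
  (M.thetaLift μ Φ f).continuous.comp (QuotientGroup.continuous_mk.comp continuous_inv)

include hj in
/-- Every coordinate `g ↦ ℓ (thetaForm … f g)` of the theta form is continuous. [folklore] -/
theorem continuous_apply_thetaForm (f : C(G ⧸ Γ, ℂ)) (ℓ : Dual ℂ W) :
    Continuous fun g => ℓ ((M.thetaForm μ hlin κ j hj ι hι f : GU → W) g) := by
  simp only [apply_thetaForm]
  exact M.continuous_thetaLiftFun μ _ f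

variable [TopologicalSpace W] [IsTopologicalAddGroup W] [ContinuousSMul ℂ W] [T2Space W] [FiniteDimensional ℂ W]

include hj in
/-- **The theta form is continuous** (finite-dimensional Hausdorff weight module). [folklore] -/
theorem continuous_thetaForm (f : C(G ⧸ Γ, ℂ)) :
    Continuous ((M.thetaForm μ hlin κ j hj ι hι f : weightForms ΓU κ τ) : GU → W) := by
  set F : GU → W := ((M.thetaForm μ hlin κ j hj ι hι f : weightForms ΓU κ τ) : GU → W) with hF
  let b := Module.finBasis ℂ W
  let e : W ≃L[ℂ] (Fin (Module.finrank ℂ W) → ℂ) := b.equivFun.toContinuousLinearEquiv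
  have hc : Continuous (e ∘ F) := continuous_pi fun i => by
    have h : (fun g => (e ∘ F) g i) = fun g => b.coord i (F g) := by
      funext g
      simp [e, b, Basis.equivFun_apply, Basis.coord_apply]
    rw [h, hF]
    exact M.continuous_apply_thetaForm μ hlin κ j hj ι hι f (b.coord i)
  have hFe : F = e.symm ∘ (e ∘ F) := by
    funext g
    simp
  rw [hFe]
  exact e.symm.continuous.comp hc

include hj in
/-- **Theta forms are CONTINUOUS weight forms** (`contWeightForms`, the domain of A1's `toLp`/`petersson`).
[folklore] -/
theorem thetaForm_mem_contWeightForms (f : C(G ⧸ Γ, ℂ)) :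
    ((M.thetaForm μ hlin κ j hj ι hι f : weightForms ΓU κ τ) : GU → W) ∈ contWeightForms ΓU κ τ :=
  ⟨(M.thetaForm μ hlin κ j hj ι hι f).2, M.continuous_thetaForm μ hlin κ j hj ι hι f⟩

end Continuity

end ThetaKernelDatum

end Literature.NumberTheory.Weil1964
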